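import Summits.QuantumFields.YangMills.Theorems.AllWindowsColdBoxTorusGreenSupplement
import Summits.QuantumFields.YangMills.Theorems.AllWindowsColdBoxBoxHighLineKernelHodgeForm
import Literature.Probability.LatticeModels.LatticeDirichletEnergy

/-!
# The 16-image formula: the Dirichlet Green function of the interior cold box is an antisymmetrised torus Green function

Route `AllWindowsColdBox`, LINE-19 S3 / LINE-20 U1 (crux ⟨stmt-QuantumFields-24336⟩, parent ⟨24004⟩; planner ym-idea-2 g17 STUB-PLAN-U1 rev 2
§6: gradient block (A) of `LandauKernelDecay`, and input (J′1)).  The gradient block of `hodgeQ⁻¹` is `d₀ᴵ Δ_I⁻² (d₀ᴵ)ᵀ` with `Δ_I` the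
scalar DIRICHLET Laplacian of the interior box `I = interiorSites H = [1, 2H−1]⁴` (✓`gradVec_dotProduct_inv_mulVec_landauCoeff`); this file
makes `Δ_I⁻¹` EXPLICIT and reflection-exact:

* **`dirichletGreen_interiorSites_eq_imageSum`** — for `x, y ∈ I`,
  `G_I(x,y) = ½ Σ_{S ⊆ {0,1,2,3}} (−1)^{|S|} G̃_{4H}(x̄ − ε_S ȳ)`,
  where `G_I = dirichletGreen (interiorSites H)` (tree, `= (8·1 − A_I)⁻¹`), `G̃_{4H} = torusGreen` on `(ℤ/4Hℤ)⁴` (twice the zero-mode-removed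
  Green function of `−Δ`), `x̄` the residue of `x`, and `ε_S` flips the signs of the coordinates in `S` (the 16 images of `y` under the
  reflections in the faces `x_ν = 0`, `x_ν = 2H` of the box `[0, 2H]⁴`, realised on the torus of the doubled period `4H`).
  Proof: the image sum is killed by `−Δ` except at `y` (✓`torusGreen_laplacian`; an image `ε_S ȳ`, `S ≠ ∅`, is never congruent to a point of `I`,
  and `Σ_S (−1)^{|S|} = 0` removes the zero-mode constant), and it VANISHES on the outer boundary of `I` (the walls `z_ν ∈ {0, 2H}`: pair `S` with
  `S ∪ {ν}` and use ✓`torusGreen_reflect`), so Green's representation formula (tree ✓`green_representation`) identifies it with `G_I(·, y)`.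
* `laplacian_imageSum`, `imageSum_eq_zero_of_wall` — the two facts just named.

With the tree's uniform torus estimates (`torusGreen_hessian_mul_dist_pow_four_le`, ✓`AllWindowsColdBoxTorusGreenGradientDecay`) this gives
gradient/Hessian bounds for `G_I` UP TO THE WALL with no Poisson-kernel/Lawler machinery (each image is at least as far from `x` as `y`).
Everything proved; no definitions; standard axioms.  HONEST LABEL: helper toward the kernel stubs of two critic-stamped DRAFT lines; no stub,
crux, rung or summit is proved; the Yang–Mills mass gap is NOT proved by this file.
-/

set_option autoImplicit false

noncomputable section

namespace Summit.QuantumFields.YangMills.Theorems.AllWindowsColdBoxBoxHighLine.BoxImage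

open Finset
open Literature.Probability.LatticeModels
open Summit.QuantumFields.YangMills.Theorems.AllWindowsColdBox.BoxKernel (torusGreen_reflect torusGreen_laplacian)

variable {H : ℕ} [NeZero H]

/-! ## Residues and images -/

omit [NeZero H] in
/-- The residue map `ℤ⁴ → (ℤ/4Hℤ)⁴` commutes with the unit steps. -/
theorem cast_add_single (x : Site 4) (ν : Fin 4) :
    (fun k => (((x + Pi.single ν 1 : Site 4) k : ℤ) : ZMod (4 * H))) =
      (fun k => ((x k : ℤ) : ZMod (4 * H))) + Pi.single ν (1 : ZMod (4 * H)) := by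
  funext k
  by_cases hk : k = ν
  · subst hk; simp
  · simp [Pi.single_eq_of_ne hk]

omit [NeZero H] in
/-- The residue map commutes with the backward unit steps. -/
theorem cast_sub_single (x : Site 4) (ν : Fin 4) :
    (fun k => (((x - Pi.single ν 1 : Site 4) k : ℤ) : ZMod (4 * H))) =
      (fun k => ((x k : ℤ) : ZMod (4 * H))) - Pi.single ν (1 : ZMod (4 * H)) := by
  funext k
  by_cases hk : k = ν
  · subst hk; simp
  · simp [Pi.single_eq_of_ne hk]

omit [NeZero H] in
/-- **The Laplacian of a periodic pull-back** is the pull-back of the torus Laplacian: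
`−Δ_{ℤ⁴}(g ∘ π)(x) = Σ_ν (2g(πx) − g(πx + e_ν) − g(πx − e_ν))`. -/
theorem neg_latticeLaplacianZd_comp_cast (g : TorusSite 4 (4 * H) → ℝ) (x : Site 4) :
    -latticeLaplacianZd (fun z : Site 4 => g (fun k => ((z k : ℤ) : ZMod (4 * H)))) x =
      ∑ ν : Fin 4, (2 * g (fun k => ((x k : ℤ) : ZMod (4 * H))) -
        g ((fun k => ((x k : ℤ) : ZMod (4 * H))) + Pi.single ν 1) -
        g ((fun k => ((x k : ℤ) : ZMod (4 * H))) - Pi.single ν 1)) := by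
  rw [latticeLaplacianZd_eq_sum_sub, ← Finset.sum_neg_distrib]
  refine Finset.sum_congr rfl fun ν _ => ?_
  simp only [cast_add_single, cast_sub_single]
  ring

/-! ## The torus Laplacian of the image sum -/

/-- `Σ_{S ⊆ Fin 4} (−1)^{|S|} = 0`. -/
theorem sum_neg_one_pow_card_univ : ∑ S : Finset (Fin 4), (-1 : ℝ) ^ S.card = 0 := by
  have h := Finset.sum_pow_mul_eq_add_pow (-1 : ℝ) 1 (Finset.univ : Finset (Fin 4))
  simp only [one_pow, mul_one, Finset.powerset_univ, Finset.card_univ, Fintype.card_fin] at h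
  rw [h]; norm_num

/-- **`−Δ` of the image sum**: for every `x ∈ ℤ⁴`,
`−Δ_{ℤ⁴}[½ Σ_S (−1)^{|S|} G̃(π· − ε_S ȳ)](x) = Σ_S (−1)^{|S|} 𝟙[πx = ε_S ȳ]` (the zero-mode constants cancel). -/
theorem laplacian_imageSum (y x : Site 4) :
    -latticeLaplacianZd (fun z : Site 4 => (1 / 2 : ℝ) * ∑ S : Finset (Fin 4), (-1 : ℝ) ^ S.card *
        torusGreen ((fun k => ((z k : ℤ) : ZMod (4 * H))) -
          (fun k => if k ∈ S then -((y k : ℤ) : ZMod (4 * H)) else ((y k : ℤ) : ZMod (4 * H))))) x =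
      ∑ S : Finset (Fin 4), (-1 : ℝ) ^ S.card *
        (if (fun k => ((x k : ℤ) : ZMod (4 * H))) =
            (fun k => if k ∈ S then -((y k : ℤ) : ZMod (4 * H)) else ((y k : ℤ) : ZMod (4 * H))) then 1 else 0) := by
  set X : TorusSite 4 (4 * H) := fun k => ((x k : ℤ) : ZMod (4 * H)) with hX
  set Y : Finset (Fin 4) → TorusSite 4 (4 * H) :=
    fun S k => if k ∈ S then -((y k : ℤ) : ZMod (4 * H)) else ((y k : ℤ) : ZMod (4 * H)) with hY
  -- image by image: the pull-back of `G̃(· − Y_S)` has `−Δ = 2·𝟙[X = Y_S] − 2/(4H)⁴`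
  have hS : ∀ S : Finset (Fin 4),
      -latticeLaplacianZd (fun z : Site 4 => torusGreen ((fun k => ((z k : ℤ) : ZMod (4 * H))) - Y S)) x =
        2 * (if X = Y S then 1 else 0) - 2 / ((4 * H : ℕ) : ℝ) ^ 4 := by
    intro S
    have h := neg_latticeLaplacianZd_comp_cast (H := H) (fun w : TorusSite 4 (4 * H) => torusGreen (w - Y S)) x
    rw [h, ← hX]
    have h2 : ∀ ν : Fin 4, 2 * torusGreen (X - Y S) - torusGreen (X + Pi.single ν 1 - Y S) - torusGreen (X - Pi.single ν 1 - Y S) =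
        2 * torusGreen (X - Y S) - torusGreen (X - Y S + Pi.single ν 1) - torusGreen (X - Y S - Pi.single ν 1) := by
      intro ν; rw [add_sub_right_comm, sub_right_comm X (Pi.single ν 1) (Y S)]
    rw [Finset.sum_congr rfl (fun ν _ => h2 ν), torusGreen_laplacian]
    simp only [sub_eq_zero]
  -- linearity of the Laplacian
  have hlin : latticeLaplacianZd (fun z : Site 4 => (1 / 2 : ℝ) * ∑ S : Finset (Fin 4), (-1 : ℝ) ^ S.card *
        torusGreen ((fun k => ((z k : ℤ) : ZMod (4 * H))) - Y S)) x =
      (1 / 2 : ℝ) * ∑ S : Finset (Fin 4), (-1 : ℝ) ^ S.card *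
        latticeLaplacianZd (fun z : Site 4 => torusGreen ((fun k => ((z k : ℤ) : ZMod (4 * H))) - Y S)) x := by
    rw [latticeLaplacianZd_const_mul, latticeLaplacianZd_finset_sum]
    congr 1
    refine Finset.sum_congr rfl fun S _ => ?_
    exact latticeLaplacianZd_const_mul _ _ _
  rw [hlin, ← mul_neg, ← Finset.sum_neg_distrib]
  have hS' : ∀ S : Finset (Fin 4), -((-1 : ℝ) ^ S.card *
      latticeLaplacianZd (fun z : Site 4 => torusGreen ((fun k => ((z k : ℤ) : ZMod (4 * H))) - Y S)) x) =
      (-1 : ℝ) ^ S.card * (2 * (if X = Y S then 1 else 0) - 2 / ((4 * H : ℕ) : ℝ) ^ 4) := by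
    intro S; rw [← hS S]; ring
  simp only [hS']
  have hsplit : ∀ S : Finset (Fin 4), (-1 : ℝ) ^ S.card * (2 * (if X = Y S then 1 else 0) - 2 / ((4 * H : ℕ) : ℝ) ^ 4) =
      2 * ((-1 : ℝ) ^ S.card * (if X = Y S then 1 else 0)) - 2 * ((-1 : ℝ) ^ S.card / ((4 * H : ℕ) : ℝ) ^ 4) := by
    intro S; ring
  simp only [hsplit, Finset.sum_sub_distrib, ← Finset.mul_sum, ← Finset.sum_div, sum_neg_one_pow_card_univ, zero_div,
    mul_zero, sub_zero]
  ring

/-- In the interior box, an image `ε_S ȳ` with `S ≠ ∅` is never the residue of an interior point, and `x̄ = ȳ` forces `x = y`: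
for `x, y ∈ interiorSites H`, `πx = ε_S ȳ ↔ S = ∅ ∧ x = y`. -/
theorem cast_eq_image_iff {x y : Site 4} (hx : x ∈ interiorSites H) (hy : y ∈ interiorSites H) (S : Finset (Fin 4)) :
    ((fun k => ((x k : ℤ) : ZMod (4 * H))) =
        fun k => if k ∈ S then -((y k : ℤ) : ZMod (4 * H)) else ((y k : ℤ) : ZMod (4 * H))) ↔ S = ∅ ∧ x = y := by
  have hbx := (interiorSites_iff H x).1 hx
  have hby := (interiorSites_iff H y).1 hy
  have hH : (0 : ℤ) < H := by exact_mod_cast Nat.pos_of_ne_zero (NeZero.ne H)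
  constructor
  · intro h
    have hk : ∀ k, ((x k : ℤ) : ZMod (4 * H)) = if k ∈ S then -((y k : ℤ) : ZMod (4 * H)) else ((y k : ℤ) : ZMod (4 * H)) :=
      fun k => congrFun h k
    have hS : S = ∅ := by
      by_contra hne
      obtain ⟨k, hkS⟩ := Finset.nonempty_iff_ne_empty.2 hne
      have h1 := hk k
      rw [if_pos hkS, ← sub_eq_zero, sub_neg_eq_add, ← Int.cast_add, ZMod.intCast_zmod_eq_zero_iff_dvd] at h1
      have h2 : x k + y k = 0 := by
        refine Int.eq_zero_of_abs_lt_dvd h1 ?_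
        have := hbx k; have := hby k
        rw [abs_of_nonneg (by omega)]; push_cast; omega
      have := hbx k; have := hby k; omega
    refine ⟨hS, funext fun k => ?_⟩
    have h1 := hk k
    rw [hS, if_neg (Finset.notMem_empty k), ← sub_eq_zero, ← Int.cast_sub, ZMod.intCast_zmod_eq_zero_iff_dvd] at h1
    have h2 : x k - y k = 0 := by
      refine Int.eq_zero_of_abs_lt_dvd h1 ?_
      have := hbx k; have := hby k
      rw [abs_lt]; push_cast; constructor <;> omega
    omega
  · rintro ⟨rfl, rfl⟩
    funext k
    simp

/-- **On the interior box the image sum is a fundamental solution**: for `x, y ∈ I`, `−Δ(image sum of y)(x) = 𝟙[x = y]`. -/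
theorem laplacian_imageSum_interior {x y : Site 4} (hx : x ∈ interiorSites H) (hy : y ∈ interiorSites H) :
    -latticeLaplacianZd (fun z : Site 4 => (1 / 2 : ℝ) * ∑ S : Finset (Fin 4), (-1 : ℝ) ^ S.card *
        torusGreen ((fun k => ((z k : ℤ) : ZMod (4 * H))) -
          (fun k => if k ∈ S then -((y k : ℤ) : ZMod (4 * H)) else ((y k : ℤ) : ZMod (4 * H))))) x =
      if x = y then 1 else 0 := by
  rw [laplacian_imageSum]
  simp only [cast_eq_image_iff hx hy]
  rw [Finset.sum_eq_single (∅ : Finset (Fin 4))]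
  · simp
  · intro S _ hS
    rw [if_neg (fun h => hS h.1), mul_zero]
  · intro h; exact absurd (Finset.mem_univ _) h

/-! ## The image sum vanishes on the walls -/

/-- **Wall vanishing**: if `2·z̄_ν = 0` in `ℤ/4Hℤ` (i.e. `z_ν ≡ 0` or `z_ν ≡ 2H`), the image sum vanishes at `z`
(pair `S ∌ ν` with `S ∪ {ν}`: the two arguments differ by the reflection `ν ↦ −ν`, ✓`torusGreen_reflect`, and the signs are opposite). -/
theorem imageSum_eq_zero_of_wall (y z : Site 4) (ν : Fin 4) (hz : ((z ν : ℤ) : ZMod (4 * H)) = -((z ν : ℤ) : ZMod (4 * H))) :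
    (1 / 2 : ℝ) * ∑ S : Finset (Fin 4), (-1 : ℝ) ^ S.card *
        torusGreen ((fun k => ((z k : ℤ) : ZMod (4 * H))) -
          (fun k => if k ∈ S then -((y k : ℤ) : ZMod (4 * H)) else ((y k : ℤ) : ZMod (4 * H)))) = 0 := by
  set Z : TorusSite 4 (4 * H) := fun k => ((z k : ℤ) : ZMod (4 * H)) with hZ
  set Y : Finset (Fin 4) → TorusSite 4 (4 * H) :=
    fun S k => if k ∈ S then -((y k : ℤ) : ZMod (4 * H)) else ((y k : ℤ) : ZMod (4 * H)) with hY
  have huniv : (Finset.univ : Finset (Finset (Fin 4))) = (insert ν ((Finset.univ : Finset (Fin 4)).erase ν)).powerset := by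
    rw [Finset.insert_erase (Finset.mem_univ ν), Finset.powerset_univ]
  have hν : ν ∉ (Finset.univ : Finset (Fin 4)).erase ν := Finset.notMem_erase ν _
  -- the reflection pairs `S` with `insert ν S`
  have hpair : ∀ S ∈ ((Finset.univ : Finset (Fin 4)).erase ν).powerset,
      torusGreen (Z - Y (insert ν S)) = torusGreen (Z - Y S) := by
    intro S hS
    have hνS : ν ∉ S := fun h => hν (Finset.mem_powerset.1 hS h)
    have key : Z - Y (insert ν S) = Function.update (Z - Y S) ν (-(Z - Y S) ν) := by
      funext k
      by_cases hk : k = ν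
      · subst hk
        simp only [Function.update_self, Pi.sub_apply, hY, Finset.mem_insert, true_or, if_true, if_neg hνS, hZ]
        linear_combination hz
      · simp only [Function.update_of_ne hk, Pi.sub_apply, hY, Finset.mem_insert, hk, false_or]
    rw [key, torusGreen_reflect]
  rw [huniv, Finset.sum_powerset_insert hν]
  rw [← Finset.sum_add_distrib, Finset.sum_eq_zero, mul_zero]
  intro S hS
  have hνS : ν ∉ S := fun h => hν (Finset.mem_powerset.1 hS h)
  rw [hpair S hS, Finset.card_insert_of_notMem hνS, pow_succ]
  ring

omit [NeZero H] in
/-- Points of the outer boundary of the interior box lie on a wall: some coordinate is `0` or `2H`. -/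
theorem exists_wall_of_mem_outerBoundary {z : Site 4} (hz : z ∈ outerBoundary (zdGraph 4) (interiorSites H)) :
    ∃ ν : Fin 4, ((z ν : ℤ) : ZMod (4 * H)) = -((z ν : ℤ) : ZMod (4 * H)) := by
  rw [mem_outerBoundary_iff] at hz
  obtain ⟨hzI, w, hw, hadj⟩ := hz
  have hbw := (interiorSites_iff H w).1 hw
  rw [zdGraph_adj_iff] at hadj
  obtain ⟨ν, hν⟩ := hadj
  -- all coordinates of `z` other than `ν` agree with `w`; `z_ν = w_ν ± 1`; since `z ∉ I`, `z_ν ∈ {0, 2H}`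
  have hzk : ∀ k, k ≠ ν → z k = w k := by
    intro k hk
    rcases hν with h | h
    · have := congrFun h k; simp [Pi.single_eq_of_ne hk] at this; omega
    · have := congrFun h k; simp [Pi.single_eq_of_ne hk] at this; omega
  have hzν : z ν = w ν + 1 ∨ z ν = w ν - 1 := by
    rcases hν with h | h
    · have := congrFun h ν; simp at this; omega
    · have := congrFun h ν; simp at this; omega
  have hwall : z ν = 0 ∨ z ν = 2 * (H : ℤ) := by
    by_contra hcon
    push Not at hcon
    apply hzI
    rw [interiorSites_iff]
    intro k
    by_cases hk : k = ν
    · subst hk; have := hbw k; omega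
    · rw [hzk k hk]; exact hbw k
  refine ⟨ν, ?_⟩
  rcases hwall with h | h
  · rw [h]; simp
  · rw [h, ← sub_eq_zero, sub_neg_eq_add, ← Int.cast_add, ZMod.intCast_zmod_eq_zero_iff_dvd]
    exact ⟨1, by push_cast; ring⟩

/-! ## The image formula -/

/-- **The 16-image formula for the Dirichlet Green function of the interior cold box**: for `x, y ∈ I = interiorSites H`,
`G_I(x,y) = ½ Σ_{S ⊆ {0,1,2,3}} (−1)^{|S|} G̃_{4H}(x̄ − ε_S ȳ)`. -/
theorem dirichletGreen_interiorSites_eq_imageSum {x y : Site 4} (hx : x ∈ interiorSites H) (hy : y ∈ interiorSites H) :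
    dirichletGreen (interiorSites H) x y =
      (1 / 2 : ℝ) * ∑ S : Finset (Fin 4), (-1 : ℝ) ^ S.card *
        torusGreen ((fun k => ((x k : ℤ) : ZMod (4 * H))) -
          (fun k => if k ∈ S then -((y k : ℤ) : ZMod (4 * H)) else ((y k : ℤ) : ZMod (4 * H)))) := by
  classical
  set F : Site 4 → ℝ := fun z => (1 / 2 : ℝ) * ∑ S : Finset (Fin 4), (-1 : ℝ) ^ S.card *
      torusGreen ((fun k => ((z k : ℤ) : ZMod (4 * H))) -
        (fun k => if k ∈ S then -((y k : ℤ) : ZMod (4 * H)) else ((y k : ℤ) : ZMod (4 * H)))) with hF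
  have hrep := green_representation (d := 4) (by norm_num) (interiorSites H) F hx
  -- the boundary term vanishes
  have hbdry : ∑ z ∈ outerBoundary (zdGraph 4) (interiorSites H), poissonKernel (interiorSites H) x z * F z = 0 := by
    refine Finset.sum_eq_zero fun z hz => ?_
    obtain ⟨ν, hν⟩ := exists_wall_of_mem_outerBoundary hz
    rw [hF]
    simp only
    rw [imageSum_eq_zero_of_wall y z ν hν, mul_zero]
  -- the volume term is `G_I(x, y)`
  have hvol : ∑ w ∈ interiorSites H, dirichletGreen (interiorSites H) x w * (-latticeLaplacianZd F w) =
      dirichletGreen (interiorSites H) x y := by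
    have h1 : ∀ w ∈ interiorSites H, dirichletGreen (interiorSites H) x w * (-latticeLaplacianZd F w) =
        if w = y then dirichletGreen (interiorSites H) x w else 0 := by
      intro w hw
      rw [hF]
      rw [laplacian_imageSum_interior hw hy]
      split_ifs <;> simp
    rw [Finset.sum_congr rfl h1, Finset.sum_ite_eq' (interiorSites H) y, if_pos hy]
  rw [hvol, hbdry, add_zero] at hrep
  exact hrep.symm

end Summit.QuantumFields.YangMills.Theorems.AllWindowsColdBoxBoxHighLine.BoxImage

end
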